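import Summits.ResolutionOfSingularities.ResolutionOfSingularities.Theorems.HilbertSamuelEliminationSigmaMaxModificationsCorridor3WLadderE1SocketIso
import Summits.ResolutionOfSingularities.ResolutionOfSingularities.Theorems.HilbertSamuelEliminationSigmaMaxModificationsCorridor3QuadricGap
import HarnessLib

/-!
# [OURS · L1 W4.2] **THE HYPERSURFACE CELL IS INTRINSIC**: the hypersurface presentation of a local ring with `ψ = d` and
# `emb.dim = d + 1` EXISTS, and the `e = 1` third door at an isolated start holds at every stage with `ψ = 3`, `emb.dim = 4`
# (crux `SigmaMaxModifications` stmt-ResolutionOfSingularities-18506 / conjunct stmt-…-19249, line `w_ladder`, row `stub_Wlow3M_two` (β);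
# `--supports 19249`, helper)

Seat res-D-pv-038 (gen 9). Sorry-free PROOF file, no definition, no named fact beyond the three doors of p545762. OURS bookkeeping
for the W4.2 crux chain (cell res-hironaka); NOT a statement of [Hironaka2017] nor of [CossartJannsenSaito2020]. AI-written; AI review
is weaker than expert review.

The hypersurface-cell theorems of the line (res-L1-w42-stub-3's `E1Free.false_of_e1MovingChain_of_isolatedHypersurfaceStage` p545762,
`…_of_hypersurfaceStage` p545136, `false_of_e1PointTower_of_hypersurfaceStage` p544245, `IsoTailsHS.false_of_pointTower_of_freeRationalTail…`
p535876, stub-2's `false_of_isIsoPointTower_of_freeRationalTail_of_hypersurfacePresentation`) carry the hypersurface stage as an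
EXTERNAL DATUM: a regular local ring `R` of characteristic `p` with `emb.dim R = 4`, a surjection `σ : R ↠ 𝒪_{X_n,x_n}` with
PRINCIPAL kernel `(h)`, `h ∈ 𝔪^m ∖ 𝔪^{m+1}`, `m ≥ 2`. This file PRODUCES that datum from intrinsic invariants of the local ring:

* §1 `exists_principal_regular_presentation` (ring level) — a reduced Noetherian local ring `A` which is a quotient of a regular
  local ring `S`, with `ψ(A) = d` (tree `minimalPrimesCodim`: the least `dim A/𝔭` over minimal primes — so `A` is equidimensional of
  dimension `d`), `dim A ≤ d` and `emb.dim A = d + 1`, is `S'/(g)` for a regular local quotient `S' = S/J` of dimension `d + 1` and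
  some `g ∈ 𝔪^m ∖ 𝔪^{m+1}`, `m ≥ 2`. This is Steps 2–3 of `TameWild.hilbertSamuelFun_eq_hypersurfaceHF_two_of_le` (p465186, the quadric
  gap) extracted verbatim with the Step-1 conclusions as hypotheses: cut `S` to the embedding dimension
  (`TameWild.exists_regular_quotient_presentation'`, Matsumura 14.2); the kernel is radical (reduced target) with height-one minimal primes
  (`height_add_ringKrullDim_quotient` and `ψ = d`), hence principal (`TameWild.eq_span_prod_of_isRadical_of_height_one`, Auslander–Buchsbaum
  `IsRegularLocalRing.uniqueFactorizationMonoid`); the exact order `m` exists by Krull intersection and `m ≥ 2` because `A` is not regular.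
* §2 `exists_regular_presentation_stalk_charP` — universe-polymorphic twin of `TameWild.exists_regular_presentation_stalk` (local rings of a
  scheme locally of finite type over a field are quotients of regular local rings = localised polynomial rings) exporting the
  characteristic; `exists_hypersurface_presentation_stalk` — §1 ∘ §2 at a point `y` of a REDUCED such scheme with `ψ_Y(y) = d`
  (`Scheme.hsPsi`), `dim 𝒪_{Y,y} ≤ d`, `emb.dim 𝒪_{Y,y} = d + 1`, in exactly the binder shape of the consumers (incl. a regular system of
  parameters `c : Fin (d+1) → R`).
* §3 `hsFun_apply_one` / `spanFinrank_eq_of_hsFun_apply_one` — the reading on the Hilbert–Samuel value: `H^N_Y(y)(1) = (N − ψ) + emb.dim`, so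
  in the W-ladder (`N = 3`) the cell is `ψ = 3 ∧ ν 1 = 4`.
* §4 **`E1Free.false_of_e1MovingChain_of_isolatedStage_of_hsPsi`** — p545762 with its nine presentation binders replaced by the two intrinsic
  ones `Scheme.hsPsi (c 0).W (c 0).pt = 3` and `(maximalIdeal 𝒪_{c 0}).spanFinrank = 4` (the structure over a field of characteristic `p`,
  reducedness and `dim ≤ 3` come from the maximal origin along `Reaches`, `IsMaximalOrigin.of_reaches`); and the `ν 1 = 4` form.
* §5 **`E1Free.noMovingNearChainFrom_of_isolatedStage_of_hsPsi`** — the third-door shape (`IsoLowDirDimTerminatesFreeM` restricted to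
  the cell, every grade `G`): from a reached stage `s` isolated in the Hilbert–Samuel locus with `e ≤ 1`, `ē ≤ 2`, `ψ = 3`, `emb.dim = 4`
  there is NO moving chain reached from `s` (`e = 0`: stub-3's `noMovingNearChainFrom_of_dirDim_eq_zero_geomDir`; `e = 1`: re-base the
  chain at `s` by stub-2's `exists_chain_from_of_reaches`, then §4) — the carrier `Corollary637_geomDir` is NOT used at these stages.

[OURS · L1 W4.2; AI-written] [cite: Matsumura1987, Thm. 14.2, Thm. 20.3] [cite: CossartJannsenSaito2020, Def. 2.28, Cor. 6.37, Thm. 3.14]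
-/

set_option linter.dupNamespace false

noncomputable section

open CategoryTheory CategoryTheory.Limits AlgebraicGeometry TopologicalSpace IsLocalRing
open Literature.RingTheory.HilbertSamuel Literature.AlgebraicGeometry.Resolution
open Literature.AlgebraicGeometry.CossartJannsenSaito2020
open Summit.ResolutionOfSingularities.ResolutionOfSingularities.Theorems.CampaignW42
open Summit.ResolutionOfSingularities.ResolutionOfSingularities.Theorems.SigmaMaxModificationsCorridor3
open Summit.ResolutionOfSingularities.ResolutionOfSingularities.Theorems.SigmaMaxModificationsCorridor3.Moving

namespace Summit.ResolutionOfSingularities.ResolutionOfSingularities.Theorems.SigmaMaxModificationsCorridor3.HypersurfaceCell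

universe u

/-! ## §1. Ring level: `ψ = d`, `emb.dim = d + 1` ⇒ a principal regular presentation of dimension `d + 1` -/

/-- **A reduced local ring with `ψ = d`, `dim ≤ d`, `emb.dim = d + 1` which is a quotient of a regular local ring is a HYPERSURFACE in a
regular local ring of dimension `d + 1`**, the equation having an exact order `m ≥ 2` (module docstring, §1).
[cite: Matsumura1987, Thm. 14.2, Thm. 20.3] -/
theorem exists_principal_regular_presentation {S : Type u} [CommRing S] [IsRegularLocalRing S]
    {A : Type u} [CommRing A] [IsLocalRing A] [IsNoetherianRing A] [IsReduced A] (f : S →+* A)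
    (hf : Function.Surjective f) {d : ℕ} (hψ : minimalPrimesCodim A = d) (hdim : ringKrullDim A ≤ d)
    (he : (maximalIdeal A).spanFinrank = d + 1) :
    ∃ (J : Ideal S) (_ : IsRegularLocalRing (S ⧸ J)) (σ : S ⧸ J →+* A) (g : S ⧸ J) (m : ℕ),
      Function.Surjective σ ∧ (maximalIdeal (S ⧸ J)).spanFinrank = d + 1 ∧ RingHom.ker σ = Ideal.span {g} ∧
        2 ≤ m ∧ g ∈ maximalIdeal (S ⧸ J) ^ m ∧ g ∉ maximalIdeal (S ⧸ J) ^ (m + 1) := by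
  classical
  -- `dim A = d` and `A` is not regular
  have hd : ringKrullDim A = d := by
    refine le_antisymm hdim ?_
    have h := minimalPrimesCodim_le_ringKrullDim A
    rwa [hψ] at h
  have hreg : ¬ IsRegularLocalRing A := by
    intro hA
    have h := hA.spanFinrank_maximalIdeal
    rw [hd, he] at h
    have : d + 1 = d := by exact_mod_cast h
    omega
  -- Step 2: a regular presentation of dimension `d + 1`
  obtain ⟨J, hJ, hregJ, hdimJ⟩ := TameWild.exists_regular_quotient_presentation' f hf
  haveI := hregJ
  set S' := S ⧸ J with hS'
  let f' : S' →+* A := Ideal.Quotient.lift J f fun a ha => hJ ha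
  have hf' : Function.Surjective f' := by
    intro a
    obtain ⟨y, rfl⟩ := hf a
    exact ⟨Ideal.Quotient.mk _ y, rfl⟩
  have hdimS' : ringKrullDim S' = ((d + 1 : ℕ) : WithBot ℕ∞) := by rw [hdimJ, he]
  have hembS' : (maximalIdeal S').spanFinrank = d + 1 := by
    have h := IsRegularLocalRing.spanFinrank_maximalIdeal (R := S')
    rw [hdimS'] at h
    exact_mod_cast h
  -- Step 3: the kernel is radical with height-one minimal primes, hence principal
  set I : Ideal S' := RingHom.ker f' with hI
  have hIrad : I.IsRadical := TameWild.isRadical_ker_of_isReduced f'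
  haveI : IsDomain S' := isDomain_of_isRegularLocalRing S'
  haveI : UniqueFactorizationMonoid S' := IsRegularLocalRing.uniqueFactorizationMonoid S'
  have hht : ∀ P ∈ I.minimalPrimes, P.height = 1 := by
    intro P hP
    have hI' : I = (⊥ : Ideal A).comap f' := by rw [hI, RingHom.ker_eq_comap_bot]
    rw [hI', Ideal.comap_minimalPrimes_eq_of_surjective hf'] at hP
    obtain ⟨𝔭, h𝔭, rfl⟩ := hP
    haveI : 𝔭.IsPrime := h𝔭.1.1
    haveI : (Ideal.comap f' 𝔭).IsPrime := Ideal.comap_isPrime f' 𝔭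
    have hsurj : Function.Surjective ((Ideal.Quotient.mk 𝔭).comp f') :=
      Ideal.Quotient.mk_surjective.comp hf'
    have hker : RingHom.ker ((Ideal.Quotient.mk 𝔭).comp f') = Ideal.comap f' 𝔭 := by
      rw [← RingHom.comap_ker, Ideal.mk_ker]
    let e : S' ⧸ Ideal.comap f' 𝔭 ≃+* A ⧸ 𝔭 :=
      (Ideal.quotEquivOfEq hker.symm).trans (RingHom.quotientKerEquivOfSurjective hsurj)
    -- `dim A/𝔭 = d` (`ψ = d` is the least such dimension, `dim A = d` the largest)
    obtain ⟨n, hn⟩ := exists_ringKrullDim_quotient_eq_nat A 𝔭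
    have hψn : minimalPrimesCodim A ≤ n := minimalPrimesCodim_le A (by exact h𝔭) hn
    have hnd : (n : WithBot ℕ∞) ≤ d := by
      rw [← hn, ← hd]
      exact ringKrullDim_quotient_le 𝔭
    have hnd' : n ≤ d := by exact_mod_cast hnd
    have hn_eq : n = d := by omega
    have hdimP : ringKrullDim (S' ⧸ Ideal.comap f' 𝔭) = (d : WithBot ℕ∞) := by
      rw [ringKrullDim_eq_of_ringEquiv e, hn, hn_eq]
    have hform := height_add_ringKrullDim_quotient (S := S') (Ideal.comap f' 𝔭)
    rw [hdimP, hdimS'] at hform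
    have hfin : (Ideal.comap f' 𝔭).height ≠ ⊤ := Ideal.height_ne_top_of_isPrime
    obtain ⟨h₀, hh₀⟩ := ENat.ne_top_iff_exists.mp hfin
    rw [← hh₀] at hform ⊢
    have hform' : ((h₀ + d : ℕ) : WithBot ℕ∞) = ((d + 1 : ℕ) : WithBot ℕ∞) := by
      rw [← hform]; push_cast; rfl
    have : h₀ + d = d + 1 := by exact_mod_cast hform'
    have : h₀ = 1 := by omega
    subst this
    rfl
  obtain ⟨T, gen, -, -, hIeq⟩ := TameWild.eq_span_prod_of_isRadical_of_height_one hIrad hht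
  set g : S' := ∏ P ∈ T, gen P with hg
  -- the exact order of `g`
  have hInetop : I ≠ ⊤ := RingHom.ker_ne_top f'
  have hgm : g ∈ maximalIdeal S' := by
    have : g ∈ I := by rw [hIeq]; exact Ideal.mem_span_singleton_self g
    exact IsLocalRing.le_maximalIdeal hInetop this
  have hIne : I ≠ ⊥ := by
    intro hbot
    apply hreg
    have hinj : Function.Injective f' := by
      rw [RingHom.injective_iff_ker_eq_bot]; exact hbot
    exact IsRegularLocalRing.of_ringEquiv (RingEquiv.ofBijective f' ⟨hinj, hf'⟩)
  have hg0 : g ≠ 0 := by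
    intro h0
    apply hIne
    rw [hIeq, h0, Ideal.span_singleton_eq_bot]
  have hex : ∃ n : ℕ, g ∉ maximalIdeal S' ^ n := by
    by_contra hall
    simp only [not_exists, not_not] at hall
    have hmem : g ∈ ⨅ n : ℕ, maximalIdeal S' ^ n := Ideal.mem_iInf.mpr hall
    rw [Ideal.iInf_pow_eq_bot_of_isLocalRing _ (IsLocalRing.maximalIdeal.isMaximal S').ne_top] at hmem
    exact hg0 hmem
  let N := Nat.find hex
  have hN : g ∉ maximalIdeal S' ^ N := Nat.find_spec hex
  have hN1 : 1 ≤ N := by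
    by_contra h
    have h0 : N = 0 := by omega
    apply hN
    rw [h0, pow_zero, Ideal.one_eq_top]
    exact Submodule.mem_top
  obtain ⟨m', hm'⟩ : ∃ m' : ℕ, N = m' + 1 := ⟨N - 1, by omega⟩
  have hgm' : g ∈ maximalIdeal S' ^ m' := by
    have h := Nat.find_min hex (m := m') (by omega)
    simpa using h
  have hgm'1 : g ∉ maximalIdeal S' ^ (m' + 1) := hm' ▸ hN
  -- `m' ≥ 2`: otherwise `A ≅ S'/(g)` would be regular
  have hkerg : RingHom.ker f' = Ideal.span {g} := hIeq
  haveI : Nontrivial (S' ⧸ Ideal.span {g}) :=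
    Ideal.Quotient.nontrivial_iff.mpr (Ideal.span_singleton_ne_top hgm)
  haveI : IsLocalRing (S' ⧸ Ideal.span {g}) := .of_surjective' _ Ideal.Quotient.mk_surjective
  let eA : (S' ⧸ Ideal.span {g}) ≃+* A :=
    (Ideal.quotEquivOfEq hkerg.symm).trans (RingHom.quotientKerEquivOfSurjective hf')
  have hm'2 : 2 ≤ m' := by
    by_contra h
    rcases Nat.lt_or_ge m' 1 with h0 | h1
    · have h00 : m' = 0 := by omega
      rw [h00, zero_add, pow_one] at hgm'1
      exact hgm'1 hgm
    · have h11 : m' = 1 := by omega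
      rw [h11] at hgm'1
      have hq := (IsRegularLocalRing.quotient_span_singleton hgm hgm'1).1
      exact hreg (IsRegularLocalRing.of_ringEquiv eA)
  exact ⟨J, hregJ, f', g, m', hf', hembS', hkerg, hm'2, hgm', hgm'1⟩

/-! ## §2. Scheme level: local rings of schemes locally of finite type over a field -/

/-- **The local rings of a scheme locally of finite type over a field of characteristic `p` are quotients of regular local rings of
characteristic `p`** (localisations of polynomial rings at primes) — `TameWild.exists_regular_presentation_stalk` (p465186's companion),
universe-polymorphic and exporting the characteristic. [folklore] -/
theorem exists_regular_presentation_stalk_charP {k : Type u} [Field k] (p : ℕ) [CharP k p] {Y : Scheme.{u}}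
    (f : Y ⟶ Spec (.of k)) [LocallyOfFiniteType f] (y : Y) :
    ∃ (S : Type u) (_ : CommRing S) (_ : IsRegularLocalRing S) (_ : Algebra k S) (σ : S →+* Y.presheaf.stalk y),
      Function.Surjective σ := by
  classical
  obtain ⟨U, hU, hyU, -⟩ :=
    exists_isAffineOpen_mem_and_subset (X := Y) (x := y) (U := ⊤) (Opens.mem_top y)
  -- `Γ(Y, U)` is a `k`-algebra of finite type
  let φ₀ : k →+* Γ(Y, U) := (f.appLE ⊤ U le_top).hom.comp (Scheme.ΓSpecIso (.of k)).inv.hom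
  have hφ₀ : φ₀.FiniteType := by
    have h1 : (f.appLE ⊤ U le_top).hom.FiniteType :=
      HasRingHomProperty.appLE @LocallyOfFiniteType f inferInstance ⟨⊤, isAffineOpen_top _⟩ ⟨U, hU⟩
        le_top
    exact h1.comp (RingHom.FiniteType.of_surjective _
      (Scheme.ΓSpecIso (.of k)).symm.commRingCatIsoToRingEquiv.surjective)
  letI : Algebra k Γ(Y, U) := φ₀.toAlgebra
  haveI : Algebra.FiniteType k Γ(Y, U) := hφ₀
  obtain ⟨n, ψ, hψ⟩ := Algebra.FiniteType.iff_quotient_mvPolynomial''.mp ‹Algebra.FiniteType k Γ(Y, U)›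
  -- the stalk is the localisation of `Γ(Y, U)` at the prime of `y`
  letI : Algebra Γ(Y, U) (Y.presheaf.stalk y) :=
    TopCat.Presheaf.algebra_section_stalk Y.presheaf ⟨y, hyU⟩
  let q : Ideal Γ(Y, U) := (hU.primeIdealOf ⟨y, hyU⟩).asIdeal
  haveI : IsLocalization.AtPrime (Y.presheaf.stalk y) q := hU.isLocalization_stalk ⟨y, hyU⟩
  -- pull back to the polynomial ring
  let Q : Ideal (MvPolynomial (Fin n) k) := q.comap ψ.toRingHom
  haveI : Q.IsPrime := Ideal.comap_isPrime _ _
  have hle : Q.primeCompl ≤ q.primeCompl.comap ψ.toRingHom := fun t ht => ht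
  let σ : Localization.AtPrime Q →+* Y.presheaf.stalk y :=
    IsLocalization.map (Y.presheaf.stalk y) ψ.toRingHom hle
  refine ⟨Localization.AtPrime Q, inferInstance, inferInstance, inferInstance, σ, ?_⟩
  intro z
  obtain ⟨⟨b, s⟩, rfl⟩ := IsLocalization.mk'_surjective q.primeCompl z
  obtain ⟨a, ha⟩ := hψ b
  obtain ⟨t, ht⟩ := hψ s
  have htQ : t ∈ Q.primeCompl := by
    show t ∉ Q
    intro htQ'
    have : (s : Γ(Y, U)) ∈ q := by rw [← ht]; exact htQ'
    exact s.2 this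
  refine ⟨IsLocalization.mk' _ a ⟨t, htQ⟩, ?_⟩
  rw [IsLocalization.map_mk']
  congr 1
  all_goals first | exact ha | exact Subtype.ext ht

/-- **THE HYPERSURFACE PRESENTATION EXISTS** at a point `y` of a REDUCED scheme locally of finite type over a field of characteristic `p`
with `ψ_Y(y) = d`, `dim 𝒪_{Y,y} ≤ d` and `emb.dim 𝒪_{Y,y} = d + 1`: a regular local ring `R` of characteristic `p` with `emb.dim R = d + 1`,
a regular system of parameters `c`, and `σ : R ↠ 𝒪_{Y,y}` with kernel `(h)`, `h ∈ 𝔪^m ∖ 𝔪^{m+1}`, `m ≥ 2` — the binder shape of the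
hypersurface-cell theorems of the line. [cite: Matsumura1987, Thm. 14.2, Thm. 20.3] -/
theorem exists_hypersurface_presentation_stalk {k : Type u} [Field k] (p : ℕ) [CharP k p] {Y : Scheme.{u}} [IsReduced Y]
    (f : Y ⟶ Spec (.of k)) [LocallyOfFiniteType f] (y : Y) {d : ℕ} (hψ : Scheme.hsPsi Y y = d)
    (hdim : ringKrullDim (Y.presheaf.stalk y) ≤ d) (he : (maximalIdeal (Y.presheaf.stalk y)).spanFinrank = d + 1) :
    ∃ (R : Type u) (_ : CommRing R) (_ : IsRegularLocalRing R) (_ : CharP R p) (c : Fin (d + 1) → R)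
      (σ : R →+* Y.presheaf.stalk y) (h : R) (m : ℕ),
      (maximalIdeal R).spanFinrank = d + 1 ∧ Ideal.span (Set.range c) = maximalIdeal R ∧ Function.Surjective σ ∧
        RingHom.ker σ = Ideal.span {h} ∧ 2 ≤ m ∧ h ∈ maximalIdeal R ^ m ∧ h ∉ maximalIdeal R ^ (m + 1) := by
  haveI : IsLocallyNoetherian Y := LocallyOfFiniteType.isLocallyNoetherian f
  obtain ⟨S, _, _, _, σ₀, hσ₀⟩ := exists_regular_presentation_stalk_charP p f y
  obtain ⟨J, hregJ, σ, g, m, hσ, hemb, hker, hm2, hgm, hgm'⟩ :=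
    exists_principal_regular_presentation σ₀ hσ₀ (d := d) hψ hdim he
  haveI := hregJ
  -- characteristic `p`: `S ⧸ J` is a non-trivial `k`-algebra
  haveI : CharP (S ⧸ J) p := charP_of_injective_algebraMap (algebraMap k (S ⧸ J)).injective p
  -- a regular system of parameters
  obtain ⟨c₀, hc₀⟩ := exists_regularSystemOfParameters (R := S ⧸ J)
  let c : Fin (d + 1) → S ⧸ J := c₀ ∘ finCongr hemb.symm
  have hc : Ideal.span (Set.range c) = maximalIdeal (S ⧸ J) := by
    rw [(finCongr hemb.symm).surjective.range_comp]; exact hc₀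
  exact ⟨S ⧸ J, inferInstance, hregJ, inferInstance, c, σ, g, m, hemb, hc, hσ, hker, hm2, hgm, hgm'⟩

/-! ## §3. The reading on the Hilbert–Samuel value: `H(1) = (N − ψ) + emb.dim` -/

/-- `H^N_Y(y)(1) = (N − ψ_Y(y)) + emb.dim 𝒪_{Y,y}` (CJS Def. 2.28 (3) at degree `1`). [cite: CossartJannsenSaito2020, Def. 2.28] -/
theorem hsFun_apply_one {Y : Scheme.{u}} [IsLocallyNoetherian Y] (N : ℕ) (y : Y) :
    Scheme.hsFun Y N y 1 = (N - Scheme.hsPsi Y y) + (maximalIdeal (Y.presheaf.stalk y)).spanFinrank := by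
  rw [Scheme.hsFun_def, Literature.RingTheory.HilbertSamuel.hilbertSamuelFun_apply_one]

/-- In the W-ladder (`N = 3`): at a point with `ψ = 3` in the stratum of a value `ν` with `ν 1 = 4`, the embedding dimension is `4`.
[cite: CossartJannsenSaito2020, Def. 2.28] -/
theorem spanFinrank_eq_four_of_hsPsi_eq_three {Y : Scheme.{u}} [IsLocallyNoetherian Y] {ν : ℕ → ℕ} {y : Y}
    (hy : y ∈ Scheme.hsStratum Y 3 ν) (hν : ν 1 = 4) (hψ : Scheme.hsPsi Y y = 3) :
    (maximalIdeal (Y.presheaf.stalk y)).spanFinrank = 4 := by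
  have h := hsFun_apply_one 3 y
  rw [Scheme.mem_hsStratum_iff.mp hy, hν, hψ] at h
  omega

/-- Conversely, with `ψ = 3` and `emb.dim = 4` the value has `ν 1 = 4`. [cite: CossartJannsenSaito2020, Def. 2.28] -/
theorem apply_one_eq_four_of_hsPsi_eq_three {Y : Scheme.{u}} [IsLocallyNoetherian Y] {ν : ℕ → ℕ} {y : Y}
    (hy : y ∈ Scheme.hsStratum Y 3 ν) (hψ : Scheme.hsPsi Y y = 3)
    (he : (maximalIdeal (Y.presheaf.stalk y)).spanFinrank = 4) : ν 1 = 4 := by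
  have h := hsFun_apply_one 3 y
  rw [Scheme.mem_hsStratum_iff.mp hy, he, hψ] at h
  omega

end Summit.ResolutionOfSingularities.ResolutionOfSingularities.Theorems.SigmaMaxModificationsCorridor3.HypersurfaceCell

/-! ## §4. The `e = 1` third door at an isolated start, hypersurface cell read intrinsically -/

namespace Summit.ResolutionOfSingularities.ResolutionOfSingularities.Theorems.SigmaMaxModificationsCorridor3.E1Free

universe u

variable {R : ∀ S : Scheme.{u}, CentreSeq S → Prop} {ν : ℕ → ℕ}

/-- `dim 𝒪_{X,x} ≤ dim X`. [cite: StacksProject, Tag 02IZ] -/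
private theorem ringKrullDim_stalk_le (X : Scheme.{u}) (x : X) :
    ringKrullDim (X.presheaf.stalk x) ≤ topologicalKrullDim X := by
  rw [AlgebraicGeometry.ringKrullDim_stalk_eq_coheight, topologicalKrullDim,
    Order.krullDim_eq_of_orderIso (irreducibleSetEquivPoints (α := X))]
  exact Order.coheight_le_krullDim x

/-- **THE `e = 1` THIRD DOOR AT AN ISOLATED START IN THE HYPERSURFACE CELL, INTRINSIC FORM**: res-L1-w42-stub-3's
`false_of_e1MovingChain_of_isolatedHypersurfaceStage` (p545762) with the hypersurface presentation PRODUCED from `ψ(𝒪_{c 0}) = 3` and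
`emb.dim 𝒪_{c 0} = 4` (`HypersurfaceCell.exists_hypersurface_presentation_stalk`; the structure over a field of characteristic `p`,
reducedness and `dim ≤ 3` of the stage come from the maximal origin, `IsMaximalOrigin.of_reaches`). From a stage `c 0` reached from a
maximal origin at level `3` (characteristic `p`), ISOLATED in the Hilbert–Samuel locus, with `e = 1`, `ē ≤ 2`, `ψ = 3`, `emb.dim = 4`, a
moving chain of canonical near steps is impossible — modulo the (F1♯) doors `Theorem314_geomDir`, `Thm314_point_locus_geomDir` and CJS
Thm. 3.10 (4) only. [cite: CossartJannsenSaito2020, Def. 6.34, Cor. 6.37, Thm. 3.14, Thm. 3.10 (4), Def. 2.28] [cite: Matsumura1987, Thm. 14.2, Thm. 20.3] -/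
theorem false_of_e1MovingChain_of_isolatedStage_of_hsPsi (hF : Theorem314_geomDir.{u})
    (h3104 : CossartJannsenSaito2020_thm_3_10_4.{u}) (h214 : Thm314_point_locus_geomDir.{u})
    (hRf : OracleFunctional R) (hRa : OracleAdmissible R) {p : ℕ} [Fact p.Prime]
    {X : Scheme.{u}} [IsLocallyNoetherian X] {x : X} (hX : IsMaximalOrigin p 3 ν X x)
    {c : ℕ → MarkedStage.{u}} (h0 : Reaches R 3 ν (MarkedStage.init X x) (c 0))
    (hstep : ∀ n, CanonicalNearStep R 3 ν (c n) (c (n + 1))) (hmov : ∀ n, ∃ m, n ≤ m ∧ (c m).IsBlownUp R 3 ν)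
    (hiso0 : Iso 3 (c 0)) (he : Moving.dirDim (c 0) = 1) (hē : (c 0).geomDirDim ≤ 2)
    (hψ : @Scheme.hsPsi (c 0).W (c 0).pt = 3)
    (hed : (maximalIdeal ((c 0).W.presheaf.stalk (c 0).pt)).spanFinrank = 4) : False := by
  haveI : IsLocallyNoetherian (c 0).W := (c 0).ln
  have hO : IsMaximalOrigin p 3 ν (c 0).W (c 0).pt := hX.of_reaches hRa h0
  obtain ⟨k, _, _, f, -, hft, -⟩ := hO.exists_structure
  haveI := hft
  haveI : IsReduced (c 0).W := hO.isReduced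
  have hdim : ringKrullDim ((c 0).W.presheaf.stalk (c 0).pt) ≤ (3 : ℕ) :=
    (ringKrullDim_stalk_le (c 0).W (c 0).pt).trans hO.dim_le
  obtain ⟨Rr, _, _, _, c4, σ, h, m, hd, hc4, hσ, hker, hm2, hm, hm'⟩ :=
    HypersurfaceCell.exists_hypersurface_presentation_stalk p f (c 0).pt hψ hdim hed
  exact false_of_e1MovingChain_of_isolatedHypersurfaceStage hF h3104 h214 hRf hRa hX h0 hstep hmov hiso0 he hē hd c4 hc4 σ hσ
    hker hm2 hm hm'

/-- **The same, read on the value**: `ν 1 = 4` and `ψ = 3` at the start. [cite: CossartJannsenSaito2020, Def. 2.28, Cor. 6.37] -/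
theorem false_of_e1MovingChain_of_isolatedStage_of_apply_one (hF : Theorem314_geomDir.{u})
    (h3104 : CossartJannsenSaito2020_thm_3_10_4.{u}) (h214 : Thm314_point_locus_geomDir.{u})
    (hRf : OracleFunctional R) (hRa : OracleAdmissible R) {p : ℕ} [Fact p.Prime]
    {X : Scheme.{u}} [IsLocallyNoetherian X] {x : X} (hX : IsMaximalOrigin p 3 ν X x)
    {c : ℕ → MarkedStage.{u}} (h0 : Reaches R 3 ν (MarkedStage.init X x) (c 0))
    (hstep : ∀ n, CanonicalNearStep R 3 ν (c n) (c (n + 1))) (hmov : ∀ n, ∃ m, n ≤ m ∧ (c m).IsBlownUp R 3 ν)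
    (hiso0 : Iso 3 (c 0)) (he : Moving.dirDim (c 0) = 1) (hē : (c 0).geomDirDim ≤ 2)
    (hν : ν 1 = 4) (hψ : @Scheme.hsPsi (c 0).W (c 0).pt = 3) : False := by
  haveI : IsLocallyNoetherian (c 0).W := (c 0).ln
  have hpt : (c 0).pt ∈ Scheme.hsStratum (c 0).W 3 ν := pt_mem_hsStratum_of_reaches hX.mem_stratum h0
  exact false_of_e1MovingChain_of_isolatedStage_of_hsPsi hF h3104 h214 hRf hRa hX h0 hstep hmov hiso0 he hē hψ
    (HypersurfaceCell.spanFinrank_eq_four_of_hsPsi_eq_three hpt hν hψ)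

/-! ## §5. The third-door shape: `IsoLowDirDimTerminatesFreeM` restricted to the hypersurface cell, intrinsic form -/

/-- **THE THIRD-DOOR SOCKET `IsoLowDirDimTerminatesFreeM` RESTRICTED TO THE HYPERSURFACE CELL** (intrinsic form, every grade
`G`): from a stage `s` reached from a maximal origin at level `3` (characteristic `p`) that is ISOLATED in the Hilbert–Samuel locus
with `e ≤ 1`, `ē ≤ 2`, `ψ = 3` and `emb.dim = 4`, there is no MOVING chain of canonical near steps reached from `s`. Case `e = 0`:
stub-3's `noMovingNearChainFrom_of_dirDim_eq_zero_geomDir` (door `Theorem314_geomDir`, no isolation, no cell); case `e = 1`: re-base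
the chain at `s` (stub-2's `exists_chain_from_of_reaches`) and §4. This is the `e ≤ 1` branch of `IsoLowDirDimTerminatesFreeM p` at the
stages of the cell WITHOUT the carrier `Corollary637_geomDir`, modulo the (F1♯) doors and CJS Thm. 3.10 (4) only.
[cite: CossartJannsenSaito2020, Cor. 6.37, Thm. 3.14, Thm. 3.10 (4), Def. 2.28] [cite: Matsumura1987, Thm. 14.2, Thm. 20.3] -/
theorem noMovingNearChainFrom_of_isolatedStage_of_hsPsi (hF : Theorem314_geomDir.{u})
    (h3104 : CossartJannsenSaito2020_thm_3_10_4.{u}) (h214 : Thm314_point_locus_geomDir.{u})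
    (hRf : OracleFunctional R) (hRa : OracleAdmissible R) {p : ℕ} [Fact p.Prime]
    {X : Scheme.{u}} [IsLocallyNoetherian X] {x : X} (hX : IsMaximalOrigin p 3 ν X x)
    {s : MarkedStage.{u}} (hreach : Reaches R 3 ν (MarkedStage.init X x) s) (hiso : Iso 3 s) (he : Moving.dirDim s ≤ 1)
    (hē : s.geomDirDim ≤ 2) (hψ : @Scheme.hsPsi s.W s.pt = 3) (hed : (maximalIdeal (s.W.presheaf.stalk s.pt)).spanFinrank = 4)
    (G : MarkedStage.{u} → Prop) : NoMovingNearChainFrom R 3 ν s G := by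
  rcases Nat.lt_or_ge (Moving.dirDim s) 1 with h0 | h1
  · exact noMovingNearChainFrom_of_dirDim_eq_zero_geomDir hF hRf hRa hX hreach (by omega) hē G
  · have he1 : Moving.dirDim s = 1 := le_antisymm he h1
    rintro ⟨c, hc0, hstep, -, hmov⟩
    -- re-base the chain at `s`
    obtain ⟨c', hc'0, hstep', hmov'⟩ := exists_chain_from_of_reaches hc0 (c := c) rfl hstep hmov
    subst hc'0
    exact false_of_e1MovingChain_of_isolatedStage_of_hsPsi hF h3104 h214 hRf hRa hX hreach hstep' hmov' hiso he1 hē hψ hed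

/-- **The same on the value** (`ν 1 = 4`, `ψ = 3`). [cite: CossartJannsenSaito2020, Cor. 6.37, Def. 2.28] -/
theorem noMovingNearChainFrom_of_isolatedStage_of_apply_one (hF : Theorem314_geomDir.{u})
    (h3104 : CossartJannsenSaito2020_thm_3_10_4.{u}) (h214 : Thm314_point_locus_geomDir.{u})
    (hRf : OracleFunctional R) (hRa : OracleAdmissible R) {p : ℕ} [Fact p.Prime]
    {X : Scheme.{u}} [IsLocallyNoetherian X] {x : X} (hX : IsMaximalOrigin p 3 ν X x)
    {s : MarkedStage.{u}} (hreach : Reaches R 3 ν (MarkedStage.init X x) s) (hiso : Iso 3 s) (he : Moving.dirDim s ≤ 1)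
    (hē : s.geomDirDim ≤ 2) (hν : ν 1 = 4) (hψ : @Scheme.hsPsi s.W s.pt = 3)
    (G : MarkedStage.{u} → Prop) : NoMovingNearChainFrom R 3 ν s G := by
  haveI : IsLocallyNoetherian s.W := s.ln
  have hpt : s.pt ∈ Scheme.hsStratum s.W 3 ν := pt_mem_hsStratum_of_reaches hX.mem_stratum hreach
  exact noMovingNearChainFrom_of_isolatedStage_of_hsPsi hF h3104 h214 hRf hRa hX hreach hiso he hē hψ
    (HypersurfaceCell.spanFinrank_eq_four_of_hsPsi_eq_three hpt hν hψ) G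

end Summit.ResolutionOfSingularities.ResolutionOfSingularities.Theorems.SigmaMaxModificationsCorridor3.E1Free

end
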